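import Summits.BirchSwinnertonDyer.BirchSwinnertonDyer.Theorems.ByReductionTypeAtTwoTowerClassKit
import HarnessLib

/-!
# TOWER road — the Néron-period binder `hper₀` on REDUCIBLE rows from Abbes–Ullmo plus ONE exact class datum:
# «`W` has the `2`-adically smallest real period in its isogeny class»

Cell `bsd-2adic` (run/shared/lean/pub/bsd-2adic/), seat `bsd-2adic-tower-1` GEN 42; `--supports stmt-BirchSwinnertonDyer-19271`
(helper, item `OrdKatoHalfAtTwo`, TOWER road). THEOREMS ONLY (no definition, no named fact, no instance, no `sorry`); closes
no item; nothing booked (D-0054); no door re-keyed (RC-500 (a): a NEW leaf); BSD is not proved by any of this.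

## What this file does

Every TOWER / `λ`-road door for a curve `W` with a rational point of order `2` (additive `λ`-road rows, non-primitive rows,
the `(T₁)`-habitat rows, the `_noHEC` doors) displays the per-row binder

  `hper₀ : ∀ f newform of W, ∀ ϖ : ℚ, ϖ · Ω(W) = Ω⁺_f → 0 ≤ v₂(ϖ)`

(on the `E[2]`-irreducible rows it is derived from Abbes–Ullmo, `TowerClass.periodRatio_nonneg_of_irr_two_of_abbesUllmo`,
because every isogeny there has odd degree). Here it is derived on ANY globally minimal `W` with good reduction at `2` from
the SAME named fact `hAU` (Abbes–Ullmo 1996 Thm. A: `2 ∤ N ⇒ 2 ∤ c₀` for the Manin constant `c₀` of a lattice-optimal datum)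
plus ONE exact datum of the isogeny class of `W`, displayed as a closed `∀`-binder:

  `hmin : ∀ W' globally minimal elliptic, W ~ W' → ∃ r : ℚ, 0 ≤ v₂(r) ∧ Ω(W') = r · Ω(W)`

(«`Ω(W)` is `2`-adically the smallest Néron period of the class»; inside a `2`-power isogeny class the period ratios are
powers of `2`, so this says `Ω(W) ≤ Ω(W')` for every member). PROOF (`padicValRat_periodRatio_nonneg_of_classPeriodMin`, any
prime `p`): Edixhoven's lattice-optimal datum `(W₀, D₀)` with the same newform exists in the class of `W`
(`ModularParametrizationData.exists_optimalDatum_of_edixhoven` + `edixhoven_int_of_neronLattice_eq_smul_periodLattice_holds`),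
`Ω(W₀) = |c₀| · Ω⁺_f` exactly (`…realPeriodRat_eq_abs_mul_plusPeriod_of_latticeEq`), and `Ω(W₀) = r · Ω(W)` by `hmin`; hence
`ϖ = r / |c₀|` and `v_p(ϖ) = v_p(r) − v_p(c₀) = v_p(r) ≥ 0` when `p ∤ c₀`.

READING (instrument; nothing re-keyed): a consumer passes `TowerPeriodDatum.periodRatio_nonneg_two_of_abbesUllmo_of_classPeriodMin
W hAU hgood hmin` (or `…_of_goodOrd … hgo hmin`) for `hper₀`; the row then displays PRINT {`hAU`} + CERT {`hmin`} instead of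
`hper₀` — the same trust base as the `E[2]`-irreducible TOWER rows. DIAGNOSTIC (docstring of
`padicValRat_periodRatio_eq_sub_of_optimalDatum`): for a member `W` that is NOT `2`-adically minimal, `hper₀ W` asserts that the
(unnamed) optimal curve `W₀` has `v₂(Ω(W₀)/Ω(W)) ≥ 0` — in a two-member class, that `W` itself is the optimal curve.

NOT claimed: which member is optimal; the Manin constant; `hmin` itself (exact class data: completeness of the isogeny class
and the rational period ratios — Cremona's tables); anything at a prime of bad reduction.
References: [AbbesUllmo1996] Thm. A; [EdixhovenManin1991] Prop. 2 and §1; [GreenbergVatsal2000] §3 Remark 3.4;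
[AgasheRibetStein2006] Thm. 2.2, appendix §5; [CremonaAlgorithms1997] §2.8.
-/

set_option autoImplicit false
-- the Theorems namespace of this sub repeats the summit name by design (D-0017 nested layout)
set_option linter.dupNamespace false

noncomputable section

open scoped Classical MatrixGroups ModularForm

open CongruenceSubgroup WeierstrassCurve Literature.NumberTheory.EllipticCurves
  Literature.NumberTheory.EllipticCurves.ModularForms Literature.NumberTheory.EllipticCurves.Rank1Residual
  Literature.NumberTheory.EllipticCurves.Rank1Residual.Typed
  Literature.NumberTheory.EllipticCurves.SkinnerUrban2014

namespace Summit.BirchSwinnertonDyer.BirchSwinnertonDyer.Theorems.TowerPeriodDatum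

variable (W : WeierstrassCurve ℚ) [W.IsElliptic]

/-! ## §1 Any prime: the period ratio against a lattice-optimal datum, and its sign from the class datum -/

/-- **`v_p(ϖ) = v_p(r) − v_p(c₀)` against a lattice-optimal datum.** For `W/ℚ` elliptic with newform `f`, a lattice-optimal
datum `D₀` (`Λ_{W₀} = c₀Λ_f`) with newform `f` on an elliptic `W₀`, a ratio `Ω(W₀) = r · Ω(W)` (`r ∈ ℚ`) and `ϖ · Ω(W) = Ω⁺_f`:
`ϖ = r / |c₀|`, so `v_p(ϖ) = v_p(r) − v_p(c₀)`. DIAGNOSTIC: if `W` is not `p`-adically period-minimal in its class, the displayed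
binder `0 ≤ v_p(ϖ)` says `v_p(c₀) ≤ v_p(Ω(W₀)/Ω(W))` for the optimal curve `W₀`. [cite: EdixhovenManin1991, §1]
[cite: CremonaAlgorithms1997, §2.8 (p. 26)] -/
theorem padicValRat_periodRatio_eq_sub_of_optimalDatum (p : ℕ) [Fact p.Prime] {N : ℕ} [NeZero N]
    {f : CuspForm (Gamma0 N) 2} {W₀ : WeierstrassCurve ℚ} [W₀.IsElliptic] (D₀ : ModularParametrizationData W₀ N)
    (hf₀ : D₀.f = f) (hopt : ∀ z ∈ D₀.L.lattice, ∃ w ∈ periodLattice D₀.f, z = D₀.c * w)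
    {r : ℚ} (hr : W₀.realPeriodRat = r * W.realPeriodRat) {ϖ : ℚ} (hϖ : (ϖ : ℝ) * W.realPeriodRat = plusPeriod f) :
    ϖ = r / |(D₀.c : ℚ)| ∧ padicValRat p ϖ = padicValRat p r - padicValInt p D₀.c := by
  have hm := D₀.realPeriodRat_eq_abs_mul_plusPeriod_of_latticeEq hopt
  rw [hf₀] at hm
  have hΩ : 0 < W.realPeriodRat := by
    haveI : (W.baseChange ℝ).IsElliptic := by rw [WeierstrassCurve.baseChange]; infer_instance
    exact (W.baseChange ℝ).realPeriod_pos'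
  have hΩ₀ : 0 < W₀.realPeriodRat := by
    haveI : (W₀.baseChange ℝ).IsElliptic := by rw [WeierstrassCurve.baseChange]; infer_instance
    exact (W₀.baseChange ℝ).realPeriod_pos'
  -- `c₀ ≠ 0` and `r ≠ 0` (both periods are positive)
  have hc0 : (D₀.c : ℝ) ≠ 0 := by
    intro h
    rw [h, abs_zero, zero_mul] at hm
    exact hΩ₀.ne' hm
  have hc0' : (D₀.c : ℚ) ≠ 0 := by exact_mod_cast hc0
  have hr0 : r ≠ 0 := by
    rintro rfl
    rw [Rat.cast_zero, zero_mul] at hr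
    exact hΩ₀.ne' hr
  -- `r Ω(W) = |c₀| ϖ Ω(W)`, so `r = |c₀| ϖ`
  have hrel : (r : ℝ) = |(D₀.c : ℝ)| * ϖ := by
    have h1 : (r : ℝ) * W.realPeriodRat = (|(D₀.c : ℝ)| * ϖ) * W.realPeriodRat := by
      rw [← hr, hm, ← hϖ]; ring
    exact mul_right_cancel₀ hΩ.ne' h1
  have hrelQ : r = |(D₀.c : ℚ)| * ϖ := by
    have : ((|(D₀.c : ℚ)| * ϖ : ℚ) : ℝ) = |(D₀.c : ℝ)| * ϖ := by push_cast; rfl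
    exact_mod_cast hrel.trans this.symm
  have habs0 : |(D₀.c : ℚ)| ≠ 0 := abs_ne_zero.mpr hc0'
  have hϖ0 : ϖ ≠ 0 := by
    rintro rfl
    exact hr0 (by rw [hrelQ, mul_zero])
  refine ⟨by rw [hrelQ, mul_div_cancel_left₀ _ habs0], ?_⟩
  have hvc : padicValRat p (|(D₀.c : ℚ)| : ℚ) = padicValInt p D₀.c := by
    rw [← Int.cast_abs, padicValRat.of_int]
    rcases abs_choice D₀.c with h | h <;> rw [h]
    simp [padicValInt, Int.natAbs_neg]
  rw [hrelQ, padicValRat.mul habs0 hϖ0, hvc]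
  ring

/-- **`0 ≤ v_p(ϖ)` from a `p`-adically minimal class period and a Manin constant prime to `p`** (any prime `p`). For `W/ℚ`
elliptic with newform `f ∈ S₂(Γ₀(N))`: assume (`hc`) the Manin constant of every lattice-optimal datum with newform `f` on a
globally minimal curve is prime to `p`, and (`hmin`) every globally minimal curve isogenous to `W` has Néron period `r · Ω(W)`
with `0 ≤ v_p(r)`. Then every `ϖ ∈ ℚ` with `ϖ · Ω(W) = Ω⁺_f` has `0 ≤ v_p(ϖ)`: Edixhoven's optimal datum `(W₀, D₀)` lies in
the class (`exists_optimalDatum_of_edixhoven`), `Ω(W₀) = |c₀|Ω⁺_f`, so `v_p(ϖ) = v_p(r) − v_p(c₀) = v_p(r)`.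
[cite: EdixhovenManin1991, Prop. 2 and §1] [cite: GreenbergVatsal2000, §3, Remark 3.4] [cite: AgasheRibetStein2006, Thm. 2.2] -/
theorem padicValRat_periodRatio_nonneg_of_classPeriodMin (p : ℕ) [Fact p.Prime] {N : ℕ} [NeZero N]
    (f : CuspForm (Gamma0 N) 2) (hf : IsNewformOf W f)
    (hc : ∀ (W₀ : WeierstrassCurve ℚ) [W₀.IsElliptic] [W₀.IsGloballyMinimal]
      (D₀ : ModularParametrizationData W₀ N), D₀.f = f →
      (∀ z ∈ D₀.L.lattice, ∃ w ∈ periodLattice D₀.f, z = D₀.c * w) → ¬ (p : ℤ) ∣ D₀.maninConstant)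
    (hmin : ∀ (W' : WeierstrassCurve ℚ) [W'.IsElliptic] [W'.IsGloballyMinimal], W.IsIsogenous W' →
      ∃ r : ℚ, 0 ≤ padicValRat p r ∧ W'.realPeriodRat = r * W.realPeriodRat)
    {ϖ : ℚ} (hϖ : (ϖ : ℝ) * W.realPeriodRat = plusPeriod f) : 0 ≤ padicValRat p ϖ := by
  obtain ⟨D⟩ := Literature.NumberTheory.Automorphic.nonempty_modularParametrizationData_of_isNewformOf hf
  have hDf : D.f = f := D.isNewformOf.unique hf
  subst hDf
  obtain ⟨W₀, hW₀, hW₀', D₀, hf₀, hiso, hopt, -⟩ :=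
    D.exists_optimalDatum_of_edixhoven
      (fun hf' hL' q hq hq' ↦ edixhoven_int_of_neronLattice_eq_smul_periodLattice_holds hf' hL' q hq hq')
  have hc₀ : ¬ (p : ℤ) ∣ D₀.c := hc W₀ D₀ hf₀ hopt
  obtain ⟨r, hr, hΩ⟩ := hmin W₀ hiso
  have hv := (padicValRat_periodRatio_eq_sub_of_optimalDatum W p D₀ hf₀ hopt hΩ hϖ).2
  have hc0 : padicValInt p D₀.c = 0 := padicValInt.eq_zero_of_not_dvd hc₀
  rw [hv, hc0]
  simpa using hr

/-! ## §2 At `p = 2`: the `hper₀` binder of the TOWER doors from Abbes–Ullmo + the class datum -/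

/-- **`hper₀` from Abbes–Ullmo + «`Ω(W)` is `2`-adically minimal in its class», good reduction at `2`.** For an
elliptic `W/ℚ` with good reduction at `2` (no minimality needed for `W` itself) (so `2 ∤ N`, `not_dvd_level_of_hasGoodReductionAtPrime`), the named fact `hAU`
(Abbes–Ullmo 1996 Thm. A: the Manin constant of a lattice-optimal datum is prime to every `p ∤ N`) and the class datum `hmin`
give the TOWER doors' binder `hper₀` verbatim: every newform `f` of `W` and every `ϖ` with `ϖ · Ω(W) = Ω⁺_f` has `0 ≤ v₂(ϖ)`.
[cite: AbbesUllmo1996, Thm. A] [cite: EdixhovenManin1991, Prop. 2 and §1] [cite: GreenbergVatsal2000, §3, Remark 3.4] -/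
theorem periodRatio_nonneg_two_of_abbesUllmo_of_classPeriodMin
    (hAU : abbesUllmo_not_dvd_maninConstant_of_not_dvd_level) (hgood : W.HasGoodReductionAtPrime 2)
    (hmin : ∀ (W' : WeierstrassCurve ℚ) [W'.IsElliptic] [W'.IsGloballyMinimal], W.IsIsogenous W' →
      ∃ r : ℚ, 0 ≤ padicValRat 2 r ∧ W'.realPeriodRat = r * W.realPeriodRat) :
    ∀ [NeZero (W.conductorNorm ℤ)] (f : CuspForm (Gamma0 (W.conductorNorm ℤ)) 2),
      IsNewformOf W f → ∀ ϖ : ℚ, (ϖ : ℝ) * W.realPeriodRat = plusPeriod f → 0 ≤ padicValRat 2 ϖ :=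
  fun f hf _ hϖ ↦ padicValRat_periodRatio_nonneg_of_classPeriodMin W 2 f hf
    (fun W₀ _ _ D₀ _ hopt ↦ hAU W₀ D₀ hopt 2 Nat.prime_two (not_dvd_level_of_hasGoodReductionAtPrime hgood hf)) hmin hϖ

/-- **`hper₀` on the TOWER road's habitat `GoodOrd W 2`** (good ordinary ⇒ good reduction at `2`), from `hAU` + the class datum
`hmin`; drop-in for the `hper₀` binder of `KatoHalfPinch.bsdp_two_of_towerGap_of_{lambda_le,towerRank}{,_noHEC}`,
`TowerLambdaTorsion.…_of_additive_rankZero`, `TowerLambdaNonPrimitive.…_typeB_rankZero` and the row files.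
[cite: AbbesUllmo1996, Thm. A] [cite: GreenbergVatsal2000, §3, Remark 3.4] -/
theorem periodRatio_nonneg_two_of_abbesUllmo_of_goodOrd_of_classPeriodMin [W.IsGloballyMinimal]
    (hAU : abbesUllmo_not_dvd_maninConstant_of_not_dvd_level) (hgo : GoodOrd W 2)
    (hmin : ∀ (W' : WeierstrassCurve ℚ) [W'.IsElliptic] [W'.IsGloballyMinimal], W.IsIsogenous W' →
      ∃ r : ℚ, 0 ≤ padicValRat 2 r ∧ W'.realPeriodRat = r * W.realPeriodRat) :
    ∀ [NeZero (W.conductorNorm ℤ)] (f : CuspForm (Gamma0 (W.conductorNorm ℤ)) 2),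
      IsNewformOf W f → ∀ ϖ : ℚ, (ϖ : ℝ) * W.realPeriodRat = plusPeriod f → 0 ≤ padicValRat 2 ϖ :=
  periodRatio_nonneg_two_of_abbesUllmo_of_classPeriodMin W hAU (show IsOrdinaryAt W 2 from hgo).1 hmin

/-- **The irreducible rows are an instance of the class datum road**: with `E[2]` irreducible the class datum `hmin` HOLDS with
`v₂(r) = 0` — every isogeny out of `W` has odd degree — and is not displayed (`TowerClass.periodRatio_nonneg_of_irr_two_of_abbesUllmo`
is the door of record there); recorded here only as the consistency check `hper₀` ⇐ `hAU` on `Irr W 2` through §1 with the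
trivial datum at `W₀` supplied by `exists_int_mul_realPeriodRat_eq_of_isogeny`. Any prime `p`, good reduction at `p`.
[cite: AbbesUllmo1996, Thm. A] [cite: GreenbergVatsal2000, §3, Remark 3.4] -/
theorem padicValRat_periodRatio_nonneg_of_irreducible_of_abbesUllmo [W.IsGloballyMinimal] (p : ℕ) [Fact p.Prime]
    (hAU : abbesUllmo_not_dvd_maninConstant_of_not_dvd_level) (hgood : W.HasGoodReductionAtPrime p)
    (hirr : W.HasIrreducibleModPGaloisRep p) {N : ℕ} [NeZero N] (f : CuspForm (Gamma0 N) 2) (hf : IsNewformOf W f)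
    {ϖ : ℚ} (hϖ : (ϖ : ℝ) * W.realPeriodRat = plusPeriod f) : 0 ≤ padicValRat p ϖ := by
  obtain ⟨u, hu, hΩ⟩ := exists_unit_mul_plusPeriod_of_irreducible_of_abbesUllmo_anyPrime hAU W p hirr f hf
    (not_dvd_level_of_hasGoodReductionAtPrime hgood hf)
  exact (Rank1Residual.padicValRat_periodRatio_eq_zero_of_eq_unit_mul W p f hu hΩ ϖ hϖ).ge

end Summit.BirchSwinnertonDyer.BirchSwinnertonDyer.Theorems.TowerPeriodDatum

end
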